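import Summits.QuantumFields.YangMills.Theorems.BalabanUVNodesN13StabilitySocketOfTopLevelLowerAtRecord13SepCoPH

/-!
# BalabanUVNodes ∕ N13 — THE RUNG's (G2)∕(G5) SOCKET NEEDS THE TOP-LEVEL LOWER HALF ONLY `dV_K`-ALMOST EVERYWHERE: the a.e. edition of this seat's g3 socket
# (`…N13StabilitySocketOfTopLevelLowerAtRecord13SepCoPH`, p602865) — so N13's input to `BalabanLadder.UV` is a VERSION-FREE statement (it reads the density of record
# only under `∫ dV_K`), in contrast with K1⁷'s (B) conjunct AS TYPED, which pins point values of the marginal-density version (this seat's p610399)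

Cell `pub-ymgap` (HUMAN RULING D-0062 Track A ∕ D-0149 width), WIDTH SEAT `pub-ymgap-dag-n13-w1` (gen 4, CLAIM-5), key K1⁷ `StabilityBAtRecordR13SepCoPH` =
stmt-QuantumFields-20542 (`--kind proof --supports … --as helper`; count-neutral).  [III] = [Balaban1988Convergent], [B10] = [Balaban1985UV3], [B16] = [Balaban1989LargeFieldII],
[Av] = [Balaban1985Averaging].

WHY.  g3's socket `lowEnvelope_of_lowerAtTop` (p602865) feeds the ladder's `LowEnvelope` from ONE number `Em` and the POINTWISE lower inequality of (2.50) at the final level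
`k = κ K`; but the chain reads that inequality only inside `∫ ρ_K dV_K ≥ e^{−Em|T|}·c_low(K)` (`T4StabilitySocket.exp_neg_mul_integral_le_of_pointwise`, whose last step is
Mathlib's `integral_mono_of_nonneg` — an a.e. statement).  THIS FILE replaces «at every `V`» by «for `dV_K`-a.e. `V`» throughout (§1 generic `FiniteEpsData`; §2 at NODE 00's
Stage-13 datum from (L2ˢ) at the top level demanded only a.e. on the small locus — off the locus the inequality holds at EVERY `V` by dag-n13-w1 g2's sign bookkeeping
`uvLower_densOfRecord₁₃_of_plaquette_off_b0`).  READING (count-neutral, for plan ∕ dag-lead ∕ the ladder owners): the rung's N13 input is an a.e. inequality for the density of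
record — a statement about its `dV_K`-CLASS, which the tree's measure theory determines — whereas K1⁷'s (B) AS TYPED is pointwise and pins point values of Mathlib's chosen
`rnDeriv` version (p610399 `exists_avgDensity_ne_zero_of_stabilityBAtRecordR13SepCoPH`); the honest N13 target TOWARD R4 is the a.e.∕integrated currency.

CONTENTS (theorems only; 0 `def`).  §1 `exp_neg_mul_integral_le_of_ae` ([folklore]) · `exp_neg_mul_smallFieldMass_le_integral_dens_of_lowerAtTop_ae` · `dressed_lower_of_lowerAtTop_ae` ·
★ `lowEnvelope_of_lowerAtTop_ae`.  §2 `uvLower_at_of_smallLocus_at` (one `U`) · ★★ `lowEnvelope_datumOfRecord₁₃SepCoPH_of_L2smallTop_ae`.  §3 (v1.1, APPEND-ONLY; same seat, same session):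
`dressed_lower_of_integratedLowerAtTop` · ★★ `lowEnvelope_of_integratedLowerAtTop` (the WEAKEST N13-side input: ONE integrated inequality `e^{−Em|T|}·c_low ≤ ∫ρ_K dV_K = ∫ρ₀ dU` per run —
no density value, no intermediate level, no version) · `integratedLowerAtTop_of_lowerAtTop_ae` (pointwise ⟹ a.e. ⟹ integrated ⟹ `LowEnvelope`).

HONEST FRAMING.  Count-neutral socket bookkeeping (one `integral_mono_of_nonneg`); the a.e. lower half ∕ (L2ˢ) are DISPLAYED hypotheses — nothing of Bałaban's asserted; N13 NOT discharged;
K0⁷∕K1⁷ NOT closed; no stub closed; counts unmoved (typed 28∕28 · discharged 5∕27, A 5∕28); one finite `𝕋⁴_{L^K}` programme at fixed `ε = L^{−K}`; route R4 closes the CONDITIONAL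
finite-𝕋⁴ rung `BalabanLadder.UV` only — the Yang–Mills mass gap (Clay) is NOT proved by any of this.  No `sorry`, `def`, `instance`, `notation`; standard axioms.
-/

noncomputable section

open MeasureTheory Filter
open scoped BigOperators Matrix.Norms.L2Operator

namespace Summit.QuantumFields.YangMills.BalabanUVNodes.N13StabilitySocketOfTopLevelLowerAEAtRecord13SepCoPH

open Literature.MathematicalPhysics.QuantumFieldTheory.Balaban1983to89
open Literature.MathematicalPhysics.QuantumFieldTheory.Balaban1983to89.T4Continuum (T4Family FiniteEpsData)
open Literature.MathematicalPhysics.QuantumFieldTheory.Balaban1983to89.Node00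
open Literature.MathematicalPhysics.QuantumFieldTheory.Balaban1983to89.T4StabilitySocket
open ExpMeanLog (deltaSU)
open B14Cor3 (ge_of_sum_repr)
open Summit.QuantumFields.YangMills.BalabanUVNodes.N13Cor3Repr218LeavesAtRecord13CoPH (densOfRecord₁₃_eq_sum)
open Summit.QuantumFields.YangMills.BalabanUVNodes.N13UVChiOffSolvableAtRecord13 (histTerm_nonneg uvLower_densOfRecord₁₃_of_plaquette_off_b0)
open Summit.QuantumFields.YangMills.BalabanUVNodes.N13StabilitySocketOfTopLevelLowerAtRecord13SepCoPH (top_le_m_add_K)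

/-! ## §1 Generic `FiniteEpsData`: the socket from an a.e. top-level lower half -/

section GenericAE

/-- **(L1) with an a.e. hypothesis**: `χ ≥ 0`, `χ·exp(−S − e) ≤ ρ` for `μ`-a.e. `x`, `ρ` integrable ⟹ `e^{−e}·∫ χ·e^{−S} ≤ ∫ ρ` (the pointwise lemma
`T4StabilitySocket.exp_neg_mul_integral_le_of_pointwise` with Mathlib's `integral_mono_of_nonneg` fed an a.e. bound). [folklore] -/
theorem exp_neg_mul_integral_le_of_ae {X : Type*} [MeasurableSpace X] {μ : Measure X} {ρ χ S : X → ℝ} {e : ℝ} (hχ : ∀ x, 0 ≤ χ x)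
    (hpt : ∀ᵐ x ∂μ, χ x * Real.exp (-S x - e) ≤ ρ x) (hρ : Integrable ρ μ) :
    Real.exp (-e) * ∫ x, χ x * Real.exp (-S x) ∂μ ≤ ∫ x, ρ x ∂μ := by
  have hnn : ∀ x, 0 ≤ χ x * Real.exp (-S x - e) := fun x => mul_nonneg (hχ x) (Real.exp_nonneg _)
  calc Real.exp (-e) * ∫ x, χ x * Real.exp (-S x) ∂μ = ∫ x, χ x * Real.exp (-S x - e) ∂μ := by
        rw [← integral_const_mul]
        refine integral_congr_ae (Eventually.of_forall fun x => ?_)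
        show Real.exp (-e) * (χ x * Real.exp (-S x)) = χ x * Real.exp (-S x - e)
        rw [show -S x - e = -S x + -e by ring, Real.exp_add]
        ring
    _ ≤ ∫ x, ρ x ∂μ := integral_mono_of_nonneg (Eventually.of_forall hnn) hρ hpt

variable {F : T4Family} {G : Type*} [GaugeGroup G] [MeasurableSpace G] [HaarData G] [RegularGaugeGroup G]

/-- **(2.50)-LOWER AT THE FINAL SCALE, INTEGRATED — from the top-level lower half `dV_K`-A.E.**: `exp(−Em·|T₁^{(K)}|)·c_low(K) ≤ ∫ρ_K dV_K`.
[cite: Balaban1988Convergent, Cor. 3 (2.50) p.264; Balaban1985UV3, (6) p.257] -/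
theorem exp_neg_mul_smallFieldMass_le_integral_dens_of_lowerAtTop_ae (D : FiniteEpsData F G) (hsign : B16.SignConventions D.C) (K : ℕ) (g₀ : ℝ) {Em : ℝ}
    (hlow : ∀ᵐ V ∂fieldMeasure (F.P K) K G,
      (D.C ⟨K, F.m, g₀⟩).χ K ((D.real.cfg K g₀ K).symm V) *
          Real.exp (-(1 / ((D.C ⟨K, F.m, g₀⟩).flow.g K) ^ 2 * (D.C ⟨K, F.m, g₀⟩).wilsonBG K ((D.real.cfg K g₀ K).symm V)) -
            Em * ((D.C ⟨K, F.m, g₀⟩).numSites K : ℝ)) ≤ D.dens K g₀ K V) :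
    Real.exp (-(Em * ((D.C ⟨K, F.m, g₀⟩).numSites K : ℝ))) * smallFieldMass D K g₀ ≤ ∫ V, D.dens K g₀ K V ∂fieldMeasure (F.P K) K G :=
  exp_neg_mul_integral_le_of_ae (μ := fieldMeasure (F.P K) K G)
    (S := fun V => 1 / ((D.C ⟨K, F.m, g₀⟩).flow.g K) ^ 2 * (D.C ⟨K, F.m, g₀⟩).wilsonBG K ((D.real.cfg K g₀ K).symm V))
    (fun _ => hsign _ _ _) hlow (integrable_dens_top D K g₀)

/-- **THE (G2) CHAIN OF ONE RUN from the top-level lower half `dV_K`-A.E.**: `e^{−|t|B}·(e^{−Em·|T₁^{(K)}|}·c_low(K)) ≤ ∫ e^{tF(U)} ρ₀(U) dU` ([B10] (6) `∫ρ_K = ∫ρ₀` and source monotonicity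
after the integrated bound). [cite: Balaban1985UV3, (6) p.257; Balaban1988Convergent, Cor. 3 (2.50) p.264] -/
theorem dressed_lower_of_lowerAtTop_ae (D : FiniteEpsData F G) (hsign : B16.SignConventions D.C) (K : ℕ) (g₀ : ℝ) {Em : ℝ}
    (hlow : ∀ᵐ V ∂fieldMeasure (F.P K) K G,
      (D.C ⟨K, F.m, g₀⟩).χ K ((D.real.cfg K g₀ K).symm V) *
          Real.exp (-(1 / ((D.C ⟨K, F.m, g₀⟩).flow.g K) ^ 2 * (D.C ⟨K, F.m, g₀⟩).wilsonBG K ((D.real.cfg K g₀ K).symm V)) -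
            Em * ((D.C ⟨K, F.m, g₀⟩).numSites K : ℝ)) ≤ D.dens K g₀ K V)
    {obs : GaugeField (F.P K) 0 G → ℝ} {B : ℝ} (hobs : Measurable obs) (hbd : ∀ U, |obs U| ≤ B) (t : ℝ) :
    Real.exp (-(|t| * B)) * (Real.exp (-(Em * ((D.C ⟨K, F.m, g₀⟩).numSites K : ℝ))) * smallFieldMass D K g₀) ≤
      ∫ U, Real.exp (t * obs U) * D.dens K g₀ 0 U ∂fieldMeasure (F.P K) 0 G :=
  calc Real.exp (-(|t| * B)) * (Real.exp (-(Em * ((D.C ⟨K, F.m, g₀⟩).numSites K : ℝ))) * smallFieldMass D K g₀)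
      ≤ Real.exp (-(|t| * B)) * ∫ V, D.dens K g₀ K V ∂fieldMeasure (F.P K) K G :=
        mul_le_mul_of_nonneg_left (exp_neg_mul_smallFieldMass_le_integral_dens_of_lowerAtTop_ae D hsign K g₀ hlow) (Real.exp_nonneg _)
    _ = Real.exp (-(|t| * B)) * ∫ U, D.dens K g₀ 0 U ∂fieldMeasure (F.P K) 0 G := by rw [D.integral_dens_eq_zero K g₀ K le_rfl]
    _ ≤ _ := exp_neg_mul_integral_dens_zero_le D K g₀ hobs hbd t

/-- **★ THE (G2)∕(G5) SOCKET FROM AN A.E. TOP-LEVEL LOWER HALF WITH ONE NUMBER** — g3's `lowEnvelope_of_lowerAtTop` with its pointwise binder `hlow` weakened to `dV_{κ K}`-a.e. for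
each `K ≥ K₀`; every other binder verbatim ((α) `hα`, (γ) `hfloor`, `hsites`, the numerator envelope).  So the ladder's stability socket reads the density of record only through
its `dV`-class. [cite: Balaban1988Convergent, Cor. 3 (2.50) p.264; Balaban1985UV3, (6) p.257] -/
theorem lowEnvelope_of_lowerAtTop_ae (D : FiniteEpsData F G) (hsign : B16.SignConventions D.C) (κ : ℕ → ℕ) (g₀ : ℕ → ℝ) {Em : ℝ} {K₀ : ℕ}
    (hlow : ∀ K, K₀ ≤ K → ∀ᵐ V ∂fieldMeasure (F.P (κ K)) (κ K) G,
      (D.C ⟨κ K, F.m, g₀ (κ K)⟩).χ (κ K) ((D.real.cfg (κ K) (g₀ (κ K)) (κ K)).symm V) *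
          Real.exp (-(1 / ((D.C ⟨κ K, F.m, g₀ (κ K)⟩).flow.g (κ K)) ^ 2 *
              (D.C ⟨κ K, F.m, g₀ (κ K)⟩).wilsonBG (κ K) ((D.real.cfg (κ K) (g₀ (κ K)) (κ K)).symm V)) -
            Em * ((D.C ⟨κ K, F.m, g₀ (κ K)⟩).numSites (κ K) : ℝ)) ≤ D.dens (κ K) (g₀ (κ K)) (κ K) V)
    {obs : (K : ℕ) → GaugeField (F.P K) 0 G → ℝ} {B l₀ : ℝ}
    (hobs : ∀ K, Measurable (obs K)) (hbd : ∀ K U, |obs K U| ≤ B)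
    {ι : Type*} {T : ℕ → Finset ι} {A : ℕ → ℝ → ι → ℝ}
    (hα : ∀ K t, |t| ≤ l₀ → K₀ ≤ K →
      ∫ U, Real.exp (t * obs (κ K) U) * D.dens (κ K) (g₀ (κ K)) 0 U ∂fieldMeasure (F.P (κ K)) 0 G ≤ ∑ τ ∈ T K, A K t τ)
    {c₀ n₁ : ℝ} (hc₀ : 0 < c₀) (hfloor : ∀ K, K₀ ≤ K → c₀ ≤ smallFieldMass D (κ K) (g₀ (κ K)))
    (hsites : ∀ K, K₀ ≤ K → ((D.C ⟨κ K, F.m, g₀ (κ K)⟩).numSites (κ K) : ℝ) ≤ n₁)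
    {nup : ℕ → ℝ → ℝ} {Nup : ℝ} (hnup : ∀ K t, |t| ≤ l₀ → K₀ ≤ K → 0 ≤ nup K t ∧ nup K t ≤ Nup) :
    LowEnvelope l₀ T A (nlowOf l₀ B (max Em 0) n₁ c₀) nup (constOf l₀ B (max Em 0) n₁ c₀ Nup) K₀ where
  low K t ht hK := by
    have hB0 : 0 ≤ B := (abs_nonneg _).trans (hbd (κ K) 1)
    have hchain := dressed_lower_of_lowerAtTop_ae D hsign (κ K) (g₀ (κ K)) (hlow K hK) (hobs (κ K)) (hbd (κ K)) t
    have hn0 : 0 ≤ ((D.C ⟨κ K, F.m, g₀ (κ K)⟩).numSites (κ K) : ℝ) := Nat.cast_nonneg _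
    have h1 : |t| * B ≤ l₀ * B := mul_le_mul_of_nonneg_right ht hB0
    have h2 : Em * ((D.C ⟨κ K, F.m, g₀ (κ K)⟩).numSites (κ K) : ℝ) ≤ max Em 0 * ((D.C ⟨κ K, F.m, g₀ (κ K)⟩).numSites (κ K) : ℝ) :=
      mul_le_mul_of_nonneg_right (le_max_left _ _) hn0
    have h3 : max Em 0 * ((D.C ⟨κ K, F.m, g₀ (κ K)⟩).numSites (κ K) : ℝ) ≤ max Em 0 * n₁ :=
      mul_le_mul_of_nonneg_left (hsites K hK) (le_max_right _ _)
    calc nlowOf l₀ B (max Em 0) n₁ c₀ K t = Real.exp (-(l₀ * B + max Em 0 * n₁)) * c₀ := rfl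
      _ ≤ Real.exp (-(|t| * B)) * (Real.exp (-(Em * ((D.C ⟨κ K, F.m, g₀ (κ K)⟩).numSites (κ K) : ℝ))) * smallFieldMass D (κ K) (g₀ (κ K))) := by
          rw [← mul_assoc, ← Real.exp_add]
          exact mul_le_mul (Real.exp_le_exp.mpr (by linarith)) (hfloor K hK) hc₀.le (Real.exp_nonneg _)
      _ ≤ ∫ U, Real.exp (t * obs (κ K) U) * D.dens (κ K) (g₀ (κ K)) 0 U ∂fieldMeasure (F.P (κ K)) 0 G := hchain
      _ ≤ ∑ τ ∈ T K, A K t τ := hα K t ht hK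
  nup_nonneg K t ht hK := (hnup K t ht hK).1
  ratio K t ht hK := by
    rw [constOf_mul_nlowOf hc₀.ne']
    exact (hnup K t ht hK).2

end GenericAE

/-! ## §2 At NODE 00's Stage-13 datum: the socket from (L2ˢ) at the top level demanded only `dV_K`-a.e. on the small locus -/

section Record

variable {F : T4Family} {N : ℕ} [NeZero N]

/-- **The lower inequality AT ONE `U` from (L2) AT THAT `U` if it lies in the small locus** (dag-n13-w1 g2's dichotomy, one configuration at a time): off the locus the (2.9) species
vanishes and `ρ_k ≥ 0` (`uvLower_densOfRecord₁₃_of_plaquette_off_b0`). [cite: Balaban1988Convergent, Cor. 3 (2.50) p.264; Balaban1987RG1, (2.9) p.266; Balaban1985Averaging, Prop. 2 (54) p.26] -/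
theorem uvLower_at_of_smallLocus_at (θ : Stage13Params F N) (hζu : IsZetaUnity F N θ.ν θ.τ9.M θ.ζ) (hζa : IsZetaAbsLeOne F N θ.ν θ.τ9.M θ.ζ)
    (hε : 0 < θ.ν.εreg) (P : B12.RunParams) {k : ℕ} (hk : k ≤ (F.P P.K).m + (F.P P.K).K)
    (hε3 : (143 * (((((F.P P.K).d + 4 : ℕ) : ℝ)) ^ 2 / 4) ^ 2) * θ.ν.εreg ≤ 1 / 3)
    (hε2 : 2 * θ.ν.εreg ≤ 2 * deltaSU (Fin N) / ((((F.P P.K).d + 4) * (F.P P.K).L : ℕ) : ℝ) ^ 2) (em : ℝ) (U : GaugeField (F.P P.K) k (SU N))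
    (hsmallU : (∀ p : Plaq (F.P P.K) k, ¬ IsB0 (F := F) (⟨p.src, p.μ⟩ : PBond (F.P P.K) k) → ¬ IsB0 (F := F) (⟨p.src.shift p.μ, p.ν⟩ : PBond (F.P P.K) k) →
        ¬ IsB0 (F := F) (⟨p.src.shift p.ν, p.μ⟩ : PBond (F.P P.K) k) → ¬ IsB0 (F := F) (⟨p.src, p.ν⟩ : PBond (F.P P.K) k) →
        dist1 (GaugeField.plaqHol U p) < 2 * θ.ν.εreg + 4 * θ.ε₂₉) →
      chiβOfRecord₁₃ F N θ P.K (gOfRecord₁₃ F N θ P) k U *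
          Real.exp (-(1 / (gOfRecord₁₃ F N θ P k) ^ 2 * wilsonBGOfRecord F N θ.εbg P k U) - em * (Fintype.card (Site (F.P P.K) k) : ℝ)) ≤
        densOfRecord₁₃ F N θ P k U) :
    chiβOfRecord₁₃ F N θ P.K (gOfRecord₁₃ F N θ P) k U *
        Real.exp (-(1 / (gOfRecord₁₃ F N θ P k) ^ 2 * wilsonBGOfRecord F N θ.εbg P k U) - em * (Fintype.card (Site (F.P P.K) k) : ℝ)) ≤
      densOfRecord₁₃ F N θ P k U := by
  by_cases h : ∃ p : Plaq (F.P P.K) k, ¬ IsB0 (F := F) (⟨p.src, p.μ⟩ : PBond (F.P P.K) k) ∧ ¬ IsB0 (F := F) (⟨p.src.shift p.μ, p.ν⟩ : PBond (F.P P.K) k) ∧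
      ¬ IsB0 (F := F) (⟨p.src.shift p.ν, p.μ⟩ : PBond (F.P P.K) k) ∧ ¬ IsB0 (F := F) (⟨p.src, p.ν⟩ : PBond (F.P P.K) k) ∧
      2 * θ.ν.εreg + 4 * θ.ε₂₉ ≤ dist1 (GaugeField.plaqHol U p)
  · obtain ⟨p, h₁, h₂, h₃, h₄, hbig⟩ := h
    exact uvLower_densOfRecord₁₃_of_plaquette_off_b0 θ hζu hζa hε P hk hε3 hε2 U p h₁ h₂ h₃ h₄ hbig em
  · exact hsmallU fun p h₁ h₂ h₃ h₄ => lt_of_not_ge fun hbig => h ⟨p, h₁, h₂, h₃, h₄, hbig⟩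

variable (θ : Stage13HParams F N) (h : θ.Provisos₁₃SepCoPH F N)

/-- **★★ THE LADDER'S (G2)∕(G5) SOCKET AT K1⁷'s RECORD FROM (L2ˢ) AT THE TOP LEVEL, DEMANDED ONLY `dV_K`-ALMOST EVERYWHERE ON THE SMALL LOCUS** — g3's
`lowEnvelope_datumOfRecord₁₃SepCoPH_of_L2smallTop` (p602865) with its binder `hL2top` weakened from «at every `V` of the small locus» to «for `dV_{κ K}`-a.e. `V`, if `V` is in the
small locus then …»; every other binder verbatim.  So what N13 owes the rung `BalabanLadder.UV` through this socket is an a.e. statement about the all-small (2.18) term at the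
final scale — a property of the `dV`-class of the density of record. [cite: Balaban1988Convergent, (2.18) p.257, Cor. 3 (2.50) p.264; Balaban1985UV3, (6) p.257; Balaban1989LargeFieldII, (0.1) pp.355–356; Balaban1987RG1, (0.1) p.251, (2.9) p.266; Balaban1985Averaging, Prop. 2 (54) p.26] -/
theorem lowEnvelope_datumOfRecord₁₃SepCoPH_of_L2smallTop_ae (hε : 0 < θ.ν.εreg) (hε3 : (143 * ((((4 + 4 : ℕ) : ℝ)) ^ 2 / 4) ^ 2) * θ.ν.εreg ≤ 1 / 3)
    (hε2 : 2 * θ.ν.εreg ≤ 2 * deltaSU (Fin N) / ((((4 + 4) * F.L : ℕ) : ℝ) ^ 2)) (κ : ℕ → ℕ) (g₀ : ℕ → ℝ) {Em : ℝ} {K₀ : ℕ}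
    (s₀ : (K : ℕ) → (reprOfRecord₁₃ F N θ.toStage13Params ⟨κ K, F.m, g₀ (κ K)⟩ (κ K)).Adm)
    (hL2top : ∀ K, K₀ ≤ K → ∀ᵐ V ∂fieldMeasure (F.P (κ K)) (κ K) (SU N),
      (∀ p : Plaq (F.P (κ K)) (κ K), ¬ IsB0 (F := F) (⟨p.src, p.μ⟩ : PBond (F.P (κ K)) (κ K)) → ¬ IsB0 (F := F) (⟨p.src.shift p.μ, p.ν⟩ : PBond (F.P (κ K)) (κ K)) →
        ¬ IsB0 (F := F) (⟨p.src.shift p.ν, p.μ⟩ : PBond (F.P (κ K)) (κ K)) → ¬ IsB0 (F := F) (⟨p.src, p.ν⟩ : PBond (F.P (κ K)) (κ K)) →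
        dist1 (GaugeField.plaqHol V p) < 2 * θ.ν.εreg + 4 * θ.ε₂₉) →
      chiβOfRecord₁₃ F N θ.toStage13Params (κ K) (gOfRecord₁₃ F N θ.toStage13Params ⟨κ K, F.m, g₀ (κ K)⟩) (κ K) V *
          Real.exp (-(1 / (gOfRecord₁₃ F N θ.toStage13Params ⟨κ K, F.m, g₀ (κ K)⟩ (κ K)) ^ 2 * wilsonBGOfRecord F N θ.εbg ⟨κ K, F.m, g₀ (κ K)⟩ (κ K) V)
            - Em * (Fintype.card (Site (F.P (κ K)) (κ K)) : ℝ)) ≤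
        (reprOfRecord₁₃ F N θ.toStage13Params ⟨κ K, F.m, g₀ (κ K)⟩ (κ K)).χ (s₀ K) V *
          (reprOfRecord₁₃ F N θ.toStage13Params ⟨κ K, F.m, g₀ (κ K)⟩ (κ K)).TexpA (s₀ K) V)
    {obs : (K : ℕ) → GaugeField (F.P K) 0 (SU N) → ℝ} {B l₀ : ℝ}
    (hobs : ∀ K, Measurable (obs K)) (hbd : ∀ K U, |obs K U| ≤ B)
    {ι : Type*} {T : ℕ → Finset ι} {A : ℕ → ℝ → ι → ℝ}
    (hα : ∀ K t, |t| ≤ l₀ → K₀ ≤ K →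
      ∫ U, Real.exp (t * obs (κ K) U) * (datumOfRecord₁₃SepCoPH F N θ h).dens (κ K) (g₀ (κ K)) 0 U ∂fieldMeasure (F.P (κ K)) 0 (SU N) ≤ ∑ τ ∈ T K, A K t τ)
    {c₀ : ℝ} (hc₀ : 0 < c₀) (hfloor : ∀ K, K₀ ≤ K → c₀ ≤ smallFieldMass (datumOfRecord₁₃SepCoPH F N θ h) (κ K) (g₀ (κ K)))
    {nup : ℕ → ℝ → ℝ} {Nup : ℝ} (hnup : ∀ K t, |t| ≤ l₀ → K₀ ≤ K → 0 ≤ nup K t ∧ nup K t ≤ Nup) :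
    LowEnvelope l₀ T A (nlowOf l₀ B (max Em 0) ((2 * (F.L : ℝ) ^ F.m) ^ 4) c₀) nup (constOf l₀ B (max Em 0) ((2 * (F.L : ℝ) ^ F.m) ^ 4) c₀ Nup) K₀ :=
  lowEnvelope_of_lowerAtTop_ae (datumOfRecord₁₃SepCoPH F N θ h) (fun p k V => (chiFix29OfRecord_mem_Icc θ.ν θ.ε₂₉ p.K k V).1) κ g₀
    (fun K hK => (hL2top K hK).mono fun V hV =>
      uvLower_at_of_smallLocus_at θ.toStage13Params h.toCore.zetaUnity h.toCore.zetaAbs hε ⟨κ K, F.m, g₀ (κ K)⟩ (top_le_m_add_K (κ K)) hε3 hε2 Em V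
        (fun hsmall => ge_of_sum_repr
          (fun s => (reprOfRecord₁₃ F N θ.toStage13Params ⟨κ K, F.m, g₀ (κ K)⟩ (κ K)).χ s V * (reprOfRecord₁₃ F N θ.toStage13Params ⟨κ K, F.m, g₀ (κ K)⟩ (κ K)).TexpA s V)
          (s₀ K) (densOfRecord₁₃_eq_sum F N θ ⟨κ K, F.m, g₀ (κ K)⟩ (κ K) V)
          (fun s => histTerm_nonneg θ.toStage13Params h.toCore.zetaUnity h.toCore.zetaAbs ⟨κ K, F.m, g₀ (κ K)⟩ (κ K) s V) (hV hsmall)))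
    hobs hbd hα hc₀ hfloor
    (fun K _ => by
      show (Fintype.card (Site (F.P (κ K)) (κ K)) : ℝ) ≤ (2 * (F.L : ℝ) ^ F.m) ^ 4
      rw [Site.card_site]
      simp [Params.sitesPerDir, T4Family.P, Missing.params4])
    hnup

end Record

/-! ## §3 (v1.1) THE WEAKEST FORM: the socket from ONE INTEGRATED INEQUALITY per run — `e^{−Em·|T₁^{(K)}|}·c_low(K) ≤ ∫ρ_K dV_K (= ∫ρ₀ dU)` — no density value,
no intermediate level, no version -/

section Integrated

variable {F : T4Family} {G : Type*} [GaugeGroup G] [MeasurableSpace G] [HaarData G] [RegularGaugeGroup G]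

/-- **THE (G2) CHAIN OF ONE RUN FROM THE INTEGRATED TOP-LEVEL LOWER INEQUALITY ALONE**: `e^{−Em·|T₁^{(K)}|}·c_low(K) ≤ ∫ρ_K dV_K` ⟹
`e^{−|t|B}·(e^{−Em·|T₁^{(K)}|}·c_low(K)) ≤ ∫ e^{tF(U)} ρ₀(U) dU` ([B10] (6) `∫ρ_K = ∫ρ₀`, `FiniteEpsData.integral_dens_eq_zero`, and source monotonicity).  This is EXACTLY what
`T4StabilitySocket.dressed_lower` consumes of (2.50). [cite: Balaban1985UV3, (6) p.257; Balaban1988Convergent, Cor. 3 (2.50) p.264 (bookkeeping)] -/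
theorem dressed_lower_of_integratedLowerAtTop (D : FiniteEpsData F G) (K : ℕ) (g₀ : ℝ) {Em : ℝ}
    (hint : Real.exp (-(Em * ((D.C ⟨K, F.m, g₀⟩).numSites K : ℝ))) * smallFieldMass D K g₀ ≤ ∫ V, D.dens K g₀ K V ∂fieldMeasure (F.P K) K G)
    {obs : GaugeField (F.P K) 0 G → ℝ} {B : ℝ} (hobs : Measurable obs) (hbd : ∀ U, |obs U| ≤ B) (t : ℝ) :
    Real.exp (-(|t| * B)) * (Real.exp (-(Em * ((D.C ⟨K, F.m, g₀⟩).numSites K : ℝ))) * smallFieldMass D K g₀) ≤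
      ∫ U, Real.exp (t * obs U) * D.dens K g₀ 0 U ∂fieldMeasure (F.P K) 0 G :=
  calc Real.exp (-(|t| * B)) * (Real.exp (-(Em * ((D.C ⟨K, F.m, g₀⟩).numSites K : ℝ))) * smallFieldMass D K g₀)
      ≤ Real.exp (-(|t| * B)) * ∫ V, D.dens K g₀ K V ∂fieldMeasure (F.P K) K G := mul_le_mul_of_nonneg_left hint (Real.exp_nonneg _)
    _ = Real.exp (-(|t| * B)) * ∫ U, D.dens K g₀ 0 U ∂fieldMeasure (F.P K) 0 G := by rw [D.integral_dens_eq_zero K g₀ K le_rfl]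
    _ ≤ _ := exp_neg_mul_integral_dens_zero_le D K g₀ hobs hbd t

/-- **★★ THE (G2)∕(G5) SOCKET FROM ONE INTEGRATED INEQUALITY PER RUN** — the weakest N13-side input the ladder's stability socket reads: for every `K ≥ K₀` the number-level
bound `e^{−Em·|T₁^{(κK)}|}·c_low(κ K) ≤ ∫ρ_{κK} dV_{κK}` of the run `⟨κ K, m, g₀(κ K)⟩` (by [B10] (6) the right side IS `∫ρ₀ dU`, the normalised bare partition function); every other
binder as in g3's `lowEnvelope_of_lowerAtTop`.  No value of any density, no intermediate level, no marginal-density version enters: the statement N13 owes the rung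
`BalabanLadder.UV` through this socket is a `K`-uniform lower bound of the top-level small-field mass against the bare partition function — version-free by construction.
[cite: Balaban1988Convergent, Cor. 3 (2.50) p.264; Balaban1985UV3, (6) p.257; Balaban1989LargeFieldII, (0.1) pp.355–356 (bookkeeping)] -/
theorem lowEnvelope_of_integratedLowerAtTop (D : FiniteEpsData F G) (κ : ℕ → ℕ) (g₀ : ℕ → ℝ) {Em : ℝ} {K₀ : ℕ}
    (hint : ∀ K, K₀ ≤ K →
      Real.exp (-(Em * ((D.C ⟨κ K, F.m, g₀ (κ K)⟩).numSites (κ K) : ℝ))) * smallFieldMass D (κ K) (g₀ (κ K)) ≤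
        ∫ V, D.dens (κ K) (g₀ (κ K)) (κ K) V ∂fieldMeasure (F.P (κ K)) (κ K) G)
    {obs : (K : ℕ) → GaugeField (F.P K) 0 G → ℝ} {B l₀ : ℝ}
    (hobs : ∀ K, Measurable (obs K)) (hbd : ∀ K U, |obs K U| ≤ B)
    {ι : Type*} {T : ℕ → Finset ι} {A : ℕ → ℝ → ι → ℝ}
    (hα : ∀ K t, |t| ≤ l₀ → K₀ ≤ K →
      ∫ U, Real.exp (t * obs (κ K) U) * D.dens (κ K) (g₀ (κ K)) 0 U ∂fieldMeasure (F.P (κ K)) 0 G ≤ ∑ τ ∈ T K, A K t τ)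
    {c₀ n₁ : ℝ} (hc₀ : 0 < c₀) (hfloor : ∀ K, K₀ ≤ K → c₀ ≤ smallFieldMass D (κ K) (g₀ (κ K)))
    (hsites : ∀ K, K₀ ≤ K → ((D.C ⟨κ K, F.m, g₀ (κ K)⟩).numSites (κ K) : ℝ) ≤ n₁)
    {nup : ℕ → ℝ → ℝ} {Nup : ℝ} (hnup : ∀ K t, |t| ≤ l₀ → K₀ ≤ K → 0 ≤ nup K t ∧ nup K t ≤ Nup) :
    LowEnvelope l₀ T A (nlowOf l₀ B (max Em 0) n₁ c₀) nup (constOf l₀ B (max Em 0) n₁ c₀ Nup) K₀ where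
  low K t ht hK := by
    have hB0 : 0 ≤ B := (abs_nonneg _).trans (hbd (κ K) 1)
    have hchain := dressed_lower_of_integratedLowerAtTop D (κ K) (g₀ (κ K)) (hint K hK) (hobs (κ K)) (hbd (κ K)) t
    have hn0 : 0 ≤ ((D.C ⟨κ K, F.m, g₀ (κ K)⟩).numSites (κ K) : ℝ) := Nat.cast_nonneg _
    have h1 : |t| * B ≤ l₀ * B := mul_le_mul_of_nonneg_right ht hB0
    have h2 : Em * ((D.C ⟨κ K, F.m, g₀ (κ K)⟩).numSites (κ K) : ℝ) ≤ max Em 0 * ((D.C ⟨κ K, F.m, g₀ (κ K)⟩).numSites (κ K) : ℝ) :=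
      mul_le_mul_of_nonneg_right (le_max_left _ _) hn0
    have h3 : max Em 0 * ((D.C ⟨κ K, F.m, g₀ (κ K)⟩).numSites (κ K) : ℝ) ≤ max Em 0 * n₁ :=
      mul_le_mul_of_nonneg_left (hsites K hK) (le_max_right _ _)
    calc nlowOf l₀ B (max Em 0) n₁ c₀ K t = Real.exp (-(l₀ * B + max Em 0 * n₁)) * c₀ := rfl
      _ ≤ Real.exp (-(|t| * B)) * (Real.exp (-(Em * ((D.C ⟨κ K, F.m, g₀ (κ K)⟩).numSites (κ K) : ℝ))) * smallFieldMass D (κ K) (g₀ (κ K))) := by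
          rw [← mul_assoc, ← Real.exp_add]
          exact mul_le_mul (Real.exp_le_exp.mpr (by linarith)) (hfloor K hK) hc₀.le (Real.exp_nonneg _)
      _ ≤ ∫ U, Real.exp (t * obs (κ K) U) * D.dens (κ K) (g₀ (κ K)) 0 U ∂fieldMeasure (F.P (κ K)) 0 G := hchain
      _ ≤ ∑ τ ∈ T K, A K t τ := hα K t ht hK
  nup_nonneg K t ht hK := (hnup K t ht hK).1
  ratio K t ht hK := by
    rw [constOf_mul_nlowOf hc₀.ne']
    exact (hnup K t ht hK).2

/-- **The a.e. top-level lower half IMPLIES the integrated inequality** (§1), so §1 ∕ §2 factor through §3: pointwise ⟹ a.e. ⟹ integrated ⟹ `LowEnvelope`.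
[cite: Balaban1988Convergent, Cor. 3 (2.50) p.264; Balaban1985UV3, (6) p.257 (bookkeeping)] -/
theorem integratedLowerAtTop_of_lowerAtTop_ae (D : FiniteEpsData F G) (hsign : B16.SignConventions D.C) (K : ℕ) (g₀ : ℝ) {Em : ℝ}
    (hlow : ∀ᵐ V ∂fieldMeasure (F.P K) K G,
      (D.C ⟨K, F.m, g₀⟩).χ K ((D.real.cfg K g₀ K).symm V) *
          Real.exp (-(1 / ((D.C ⟨K, F.m, g₀⟩).flow.g K) ^ 2 * (D.C ⟨K, F.m, g₀⟩).wilsonBG K ((D.real.cfg K g₀ K).symm V)) -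
            Em * ((D.C ⟨K, F.m, g₀⟩).numSites K : ℝ)) ≤ D.dens K g₀ K V) :
    Real.exp (-(Em * ((D.C ⟨K, F.m, g₀⟩).numSites K : ℝ))) * smallFieldMass D K g₀ ≤ ∫ V, D.dens K g₀ K V ∂fieldMeasure (F.P K) K G :=
  exp_neg_mul_smallFieldMass_le_integral_dens_of_lowerAtTop_ae D hsign K g₀ hlow

end Integrated

end Summit.QuantumFields.YangMills.BalabanUVNodes.N13StabilitySocketOfTopLevelLowerAEAtRecord13SepCoPH

end
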